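import Mathlib
import HarnessLib
import Summits.HubbardSuperconductivity.HubbardSuperconductivity.Theorems.KLProgrammeKLRegimeSplitPhValueTransferShifts
import Summits.HubbardSuperconductivity.HubbardSuperconductivity.Theorems.KLProgrammeKLRegimeSplitPhValueDiagonalWeighted
import Summits.HubbardSuperconductivity.HubbardSuperconductivity.Theorems.KLProgrammeKLRegimeSplitPhValueExchangeBound

/-!
# Route `KLProgramme` — ENGINE (stmt-HubbardSuperconductivity-20437 `KLRegimeEngineV17F2`), row (c) binder #8 (★ v19 `hexLadMV`), the DIRECT p-h value row `RP` AT EVERY PINNED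
# PAIR `(x, y)` (off the diagonal), θ-RESOLVED: diagonal object (window-profile moduli O6e″ + rotation per angle O6i-c) with the two partner values + a correction LINEAR in
# the transfer's band shift — brick O6k-b, the momentum twin of O6h-e
# (cell gate-hubbard-kl, seat hubbard-kl-k3c2-p2 g32, technique «thermal-bar induction n ≤ nScales β + 1 with EngineBoundsAtV4S sums»)

WHY.  The rows door `klmd_defect_le_rows_family` asks for `hP` at every `(x, y)`; O6f′ `klph_directRow_diag_le_weighted` is the case `y = x`.  After O6f `klph_directRow_eq` the
partner label is `p⁺ = (p.1, p.2 + (x − y))`; O6k-a `klph_transfer_decomp_abstract` re-indexes the first bubble ordering by the torus translation and writes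
`RP(x,y) = Σ_pΣ_σ (Ẇ_tβL²ĝ)(p)(Φ_jβL²ĝ)(p)·(F p⁻ σ p + F p σ p⁺) + Σ_pΣ_σ (Ẇ_tβL²ĝ)(p)·[((Φ_jβL²ĝ)(p⁻) − (Φ_jβL²ĝ)(p))·F p⁻ σ p + ((Φ_jβL²ĝ)(p⁺) − (Φ_jβL²ĝ)(p))·F p σ p⁺]`.
The first sum is the DIAGONAL object: O6e″ `klph_phValue_row_profile_ref_le` (reference field `V₀ p σ` for the SUM of the two partner values, window profile `(ε; cen_w, ρ_w, A_w)`)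
+ O6i-c `klpw_phValue_row_weighted_le` (rotation per Fermi-surface angle, weights `w₁, w₂`).  The second is bounded sign-blind by O6k-a `klph_shift_corr_abstract_le` with the
hard line `‖Ẇ_tβL²ĝ‖ ≤ βL²(128/3)/Λ(t)²`, the soft-line shift `‖(Φ_jβL²ĝ)(p^±) − (Φ_jβL²ĝ)(p)‖ ≤ βL²·(2/Λ(t))·(d_q·G_q + ε_q)` on the hard shell (resolvent identity in the
momentum variable `klph_norm_propCT_msub_le`: `|e_K(k̃ ± q) − e_K(k̃)| ≤ d_q`, shifted rung `G_q`, member-symbol shift `ε_q`) and the partner kernels' sup `F∞`: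
`(Λₙ−Λₙ₊₁)·N_sh·(βL²)⁻¹·(128/3)Λ(t)⁻²·2·2·(2/Λ(t))·(d_q G_q + ε_q)·F∞` — LINEAR in `d_q ≤ (4 + ‖K‖₁)‖x − y‖_𝕋` (O6k-a `klph_bandShift_le`): the «Lindhard value, linear decay
below the p-h plateau» of E1-LEDGER line #8 / located #23 on the closer side.  The data `G_q = 4/Λ(t)`, `ε_q = (128/Λ²)d_q(2Λ + d_q)` are O6k-a's
`klph_norm_propCT_mshift_le` / `klph_memberSymbol_mshift_le` in the near-diagonal regime `8d_q ≤ Λ(t)`; beyond it (above the plateau) O6j `klph_phValue_row_signBlind_le` is the row.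

* **`klph_directRow_transfer_le_weighted`** — the bound in the rows door's literal shape (any `c : ℤ`, any `x y`), data: O6f′'s (frame, chart, radial profile, reference field +
  window profile for `F p⁻ σ p + F p σ p⁺`, angular weights) + (`F∞, G_q, ε_q, d_q`).  At `y = x` it is O6f′ with `d_q = ε_q = 0` allowed (the correction vanishes by value).
Pure composition; no definitions; nothing asserts (c), K3 or superconductivity.  [cite: BenfattoGiulianiMastropietro2006, §2.4–§2.5]
-/

noncomputable section

namespace Summit.HubbardSuperconductivity.HubbardSuperconductivity.Theorems.KLRegimeSplit

set_option linter.dupNamespace false -- summit = problem name (single-conjunct summit), D-0017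

open Real Set Finset Literature.MathematicalPhysics.QuantumLattice
open Literature.Probability.LatticeModels hiding torusSupNorm
open Literature.MathematicalPhysics.QuantumLattice.BandSectorCounting
open Summit.HubbardSuperconductivity.HubbardSuperconductivity.Theorems.TwoPointAssembly
open Summit.HubbardSuperconductivity.HubbardSuperconductivity.Theorems.KLProgrammeLegKernels
open Summit.HubbardSuperconductivity.HubbardSuperconductivity.Theorems.KLRegimeWick
open Summit.HubbardSuperconductivity.HubbardSuperconductivity.Theorems.EngineV8
open Summit.HubbardSuperconductivity.HubbardSuperconductivity.Theorems.DispersionFlow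
open Summit.HubbardSuperconductivity.HubbardSuperconductivity.Theorems.PerturbedFermiCurve
open Summit.HubbardSuperconductivity.HubbardSuperconductivity.Theorems.C4a

variable {L M : ℕ} [NeZero L] [NeZero M]

section TransferWeighted

variable {R : RenConsts} {U : ℝ} {N : ℕ}

/-- **THE DIRECT p-h ROW AT EVERY PINNED PAIR, θ-RESOLVED** (module docstring): diagonal object with the two partner values (O6e″ + O6i-c) + the correction linear in the
transfer's band shift `d_q`.  [cite: BenfattoGiulianiMastropietro2006, §2.4–§2.5] -/
theorem klph_directRow_transfer_le_weighted {β μ : ℝ} {K : TrigPolyC4v} (hK : FrameOK R U N μ K) (hβ : klBetaMin ≤ β) (hβL : β ≤ L)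
    {a b : ℝ} (B : BandBounds a b) {A : ℝ} (hA : ∀ p : Momentum, ∀ j ≤ 2, ‖iteratedFDeriv ℝ j (frameShift K) p‖ ≤ A) (hADt : 2 * A < B.Dtmin)
    {r : ℝ} (hlo : a < μ - r - A) (hhi : μ + r + A < b) (n : ℕ) {t : ℝ} (ht : t ∈ Icc (0 : ℝ) 1)
    (Φ : ℕ → ℝ → FreqMomentum L M → ℝ) (hΦ : Φ = fun j t k => (softSymbolCompl L M β μ K (n + 1) j) k + (hubbardCutoffWeightCT L M β μ K (klScale klE0 (n + 1)) k -
            hubbardCutoffWeightCT L M β μ K (klScale klE0 n + t * (klScale klE0 (n + 1) - klScale klE0 n)) k))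
    (Wd : ℝ → FreqMomentum L M → ℝ) (hWd : Wd = fun t k => deriv (fun Λ' : ℝ => hubbardCutoffWeightCT L M β μ K Λ' k) (klScale klE0 n + t * (klScale klE0 (n + 1) - klScale klE0 n)))
    {j : ℕ} (hj : n + 1 ≤ j) (hΛr : klScale klE0 n + t * (klScale klE0 (n + 1) - klScale klE0 n) < r)
    (hM : β * (klScale klE0 n + t * (klScale klE0 (n + 1) - klScale klE0 n)) / (2 * Real.pi) + 1 ≤ M)
    {Mg ℓ r₁ : ℝ} (hr₁ : 0 < r₁)
    (hbd : ∀ s, |klWd (klScale klE0 n + t * (klScale klE0 (n + 1) - klScale klE0 n)) s *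
      klPhi (klScale klE0 j) (klScale klE0 n + t * (klScale klE0 (n + 1) - klScale klE0 n)) s| ≤ Mg)
    (hlip : ∀ s s', |klWd (klScale klE0 n + t * (klScale klE0 (n + 1) - klScale klE0 n)) s *
        klPhi (klScale klE0 j) (klScale klE0 n + t * (klScale klE0 (n + 1) - klScale klE0 n)) s -
      klWd (klScale klE0 n + t * (klScale klE0 (n + 1) - klScale klE0 n)) s' *
        klPhi (klScale klE0 j) (klScale klE0 n + t * (klScale klE0 (n + 1) - klScale klE0 n)) s'| ≤ ℓ * |s - s'|)
    (hin : ∀ s, s ≤ r₁ ^ 2 → klWd (klScale klE0 n + t * (klScale klE0 (n + 1) - klScale klE0 n)) s *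
      klPhi (klScale klE0 j) (klScale klE0 n + t * (klScale klE0 (n + 1) - klScale klE0 n)) s = 0)
    (hout : ∀ s, (klScale klE0 n + t * (klScale klE0 (n + 1) - klScale klE0 n)) ^ 2 ≤ s →
      klWd (klScale klE0 n + t * (klScale klE0 (n + 1) - klScale klE0 n)) s *
        klPhi (klScale klE0 j) (klScale klE0 n + t * (klScale klE0 (n + 1) - klScale klE0 n)) s = 0)
    (F : FreqMomentum L M → Fin 2 → FreqMomentum L M → ℂ) (c : ℤ) (x y : TorusSite 2 L)
    -- the reference field and its window profile on the hard shell
    (V₀ : FreqMomentum L M → Fin 2 → ℂ) {ε : ℝ} (hε0 : 0 ≤ ε) {m : ℕ} (cen : Fin m → TorusSite 2 L) (ρw Aw : Fin m → ℝ) (hρw : ∀ w, 0 ≤ ρw w) (hAw : ∀ w, 0 ≤ Aw w)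
    (hδ : ∀ p : FreqMomentum L M, ∀ σ : Fin 2, Wd t p ≠ 0 →
      ‖(F (p.1, p.2 - (x - y)) σ p + F p σ (p.1, p.2 + (x - y))) - V₀ p σ‖ ≤ ε + ∑ w : Fin m, if klTorusNorm L (p.2 - cen w) ≤ ρw w then Aw w else 0)
    -- the angular weights of the reference field's spin sum
    (w₁ w₂ : ℝ × ℝ → ℝ) (v₁ v₂ : ℝ → ℝ) (hvm₁ : Measurable v₁) (hvm₂ : Measurable v₂) (hvp₁ : Function.Periodic v₁ (2 * π)) (hvp₂ : Function.Periodic v₂ (2 * π))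
    {Bv : ℝ} (hvb₁ : ∀ ϑ, |v₁ ϑ| ≤ Bv) (hvb₂ : ∀ ϑ, |v₂ ϑ| ≤ Bv)
    (hw₁ : ∀ p : ℝ × ℝ, p.1 ∈ Ioo (-r) r → w₁ (levelChart μ K p) = v₁ p.2) (hw₂ : ∀ p : ℝ × ℝ, p.1 ∈ Ioo (-r) r → w₂ (levelChart μ K p) = v₂ p.2)
    (hwc₁ : Continuous w₁) (hwc₂ : Continuous w₂) (hw1₁ : ∀ x y, w₁ (x + 2 * π, y) = w₁ (x, y)) (hw2₁ : ∀ x y, w₁ (x, y + 2 * π) = w₁ (x, y))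
    (hw1₂ : ∀ x y, w₂ (x + 2 * π, y) = w₂ (x, y)) (hw2₂ : ∀ x y, w₂ (x, y + 2 * π) = w₂ (x, y))
    {Lw Bw : ℝ} (hLw : 0 ≤ Lw) (hwlip₁ : ∀ p q : ℝ × ℝ, |w₁ p - w₁ q| ≤ Lw * dist p q) (hwlip₂ : ∀ p q : ℝ × ℝ, |w₂ p - w₂ q| ≤ Lw * dist p q)
    (hwb₁ : ∀ p, |w₁ p| ≤ Bw) (hwb₂ : ∀ p, |w₂ p| ≤ Bw)
    (hV : ∀ p : FreqMomentum L M, ∑ s : Fin 2, V₀ p s =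
      ((w₁ (latticeMomentum L p.2 0, latticeMomentum L p.2 1) : ℝ) : ℂ) + ((w₂ (latticeMomentum L p.2 0, latticeMomentum L p.2 1) : ℝ) : ℂ) * Complex.I)
    -- the one-more-rung data of the transfer `q = x − y` on the hard shell
    {Finf Gq εq dq : ℝ} (hF0 : 0 ≤ Finf) (hG0 : 0 ≤ Gq) (hεq0 : 0 ≤ εq) (hdq0 : 0 ≤ dq)
    (hF : ∀ p : FreqMomentum L M, ∀ σ : Fin 2, Wd t p ≠ 0 → ‖F (p.1, p.2 - (x - y)) σ p‖ ≤ Finf ∧ ‖F p σ (p.1, p.2 + (x - y))‖ ≤ Finf)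
    (hG : ∀ p : FreqMomentum L M, Wd t p ≠ 0 → ‖propCT L M β μ K (p.1, p.2 - (x - y))‖ ≤ Gq ∧ ‖propCT L M β μ K (p.1, p.2 + (x - y))‖ ≤ Gq)
    (hdq : ∀ k : TorusSite 2 L, |nambuXiCT L μ K (k - (x - y)) - nambuXiCT L μ K k| ≤ dq ∧ |nambuXiCT L μ K (k + (x - y)) - nambuXiCT L μ K k| ≤ dq)
    (hε : ∀ p : FreqMomentum L M, Wd t p ≠ 0 → |Φ j t (p.1, p.2 - (x - y)) - Φ j t p| ≤ εq ∧ |Φ j t (p.1, p.2 + (x - y)) - Φ j t p| ≤ εq) :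
    (klScale klE0 n - klScale klE0 (n + 1)) * ((β * (L : ℝ) ^ 2) ^ 3)⁻¹ *
      ‖∑ p : FreqMomentum L M, ∑ σ : Fin 2, ∑ p' : FreqMomentum L M,
        (if matsubaraInt M p'.1 + c = matsubaraInt M p.1 + c ∧ p'.2 = p.2 + x - y then
          (((((Φ j t p) : ℝ) : ℂ) * (((β * (L : ℝ) ^ 2 : ℝ) : ℂ) * propCT L M β μ K p)) * ((((Wd t p') : ℝ) : ℂ) * (((β * (L : ℝ) ^ 2 : ℝ) : ℂ) * propCT L M β μ K p')) +
            ((((Wd t p) : ℝ) : ℂ) * (((β * (L : ℝ) ^ 2 : ℝ) : ℂ) * propCT L M β μ K p)) * ((((Φ j t p') : ℝ) : ℂ) * (((β * (L : ℝ) ^ 2 : ℝ) : ℂ) * propCT L M β μ K p'))) *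
            F p σ p'
        else 0)‖ ≤
      (klScale klE0 n - klScale klE0 (n + 1)) * (2 *
        (((2 * π) ^ 2)⁻¹ * (Bv * (2 * π * (π * Real.sqrt 2 / (B.Dtmin - 2 * A)) *
              ((2 * (klScale klE0 n + t * (klScale klE0 (n + 1) - klScale klE0 n)) * (2 * (klScale klE0 n + t * (klScale klE0 (n + 1) - klScale klE0 n)) *
                (2 * (klScale klE0 n + t * (klScale klE0 (n + 1) - klScale klE0 n)) ^ 2 * (ℓ / r₁ ^ 4 + 2 * Mg / r₁ ^ 6) + (ℓ / r₁ ^ 2 + Mg / r₁ ^ 4)))) *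
                ((klScale klE0 n + t * (klScale klE0 (n + 1) - klScale klE0 n)) + 2 * Real.pi / β) / β) +
            β⁻¹ * (((klScale klE0 n + t * (klScale klE0 (n + 1) - klScale klE0 n)) * β / π + 1) *
              (2 * (klScale klE0 n + t * (klScale klE0 (n + 1) - klScale klE0 n)) *
                (2 * π * (1 / (B.Dtmin - 2 * A) ^ 2 + Real.pi * Real.sqrt 2 * (2 + 4 * A) / (B.Dtmin - 2 * A) ^ 3) *
                  (klScale klE0 n + t * (klScale klE0 (n + 1) - klScale klE0 n)) * (Mg / r₁ ^ 2)))))) +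
          ((klScale klE0 n + t * (klScale klE0 (n + 1) - klScale klE0 n)) / π + 3 / β) *
            (2 * π * (Bw * (2 * (klScale klE0 n + t * (klScale klE0 (n + 1) - klScale klE0 n)) *
              (2 * (klScale klE0 n + t * (klScale klE0 (n + 1) - klScale klE0 n)) ^ 2 * (ℓ / r₁ ^ 4 + 2 * Mg / r₁ ^ 6) + (ℓ / r₁ ^ 2 + Mg / r₁ ^ 4)) *
              (4 + 2 * A)) + Lw * (Mg / r₁ ^ 2)) / L))) +
        ((2 : ℝ) ^ 10 * 15367 * ε + ∑ w : Fin m, (2 : ℝ) ^ 10 * 15381 * (ρw w / π + ((L : ℝ))⁻¹) * Aw w) +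
        (klScale klE0 n - klScale klE0 (n + 1)) * ((univ.filter fun p : FreqMomentum L M => Wd t p ≠ 0).card : ℝ) * (β * (L : ℝ) ^ 2)⁻¹ *
          ((128 / 3 / (klScale klE0 n + t * (klScale klE0 (n + 1) - klScale klE0 n)) ^ 2) *
            (2 * (2 * ((2 / (klScale klE0 n + t * (klScale klE0 (n + 1) - klScale klE0 n))) * (dq * Gq + εq)) * Finf))) := by
  classical
  have hβ0 : 0 < β := pos_of_klBetaMin_le hβ
  have hL : (0 : ℝ) < L := hβ0.trans_le hβL
  have hβL2 : 0 < β * (L : ℝ) ^ 2 := by positivity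
  have h10 := (klmf_klScale_succ_pos_le n).2
  have h1 := (klmf_klScale_succ_pos_le n).1
  have hmem := klws_affine_mem_Icc h10 ht
  set Λt : ℝ := klScale klE0 n + t * (klScale klE0 (n + 1) - klScale klE0 n) with hΛt_def
  have hΛt : 0 < Λt := h1.trans_le hmem.1
  have hdiff : 0 ≤ klScale klE0 n - klScale klE0 (n + 1) := by linarith
  have hC : 0 ≤ (klScale klE0 n - klScale klE0 (n + 1)) * ((β * (L : ℝ) ^ 2) ^ 3)⁻¹ := by positivity
  set q : TorusSite 2 L := x - y with hq_def
  -- the two lines as functions of the label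
  set hard : FreqMomentum L M → ℂ := fun p => (((Wd t p) : ℝ) : ℂ) * (((β * (L : ℝ) ^ 2 : ℝ) : ℂ) * propCT L M β μ K p) with hhard_def
  set soft : FreqMomentum L M → ℂ := fun p => (((Φ j t p) : ℝ) : ℂ) * (((β * (L : ℝ) ^ 2 : ℝ) : ℂ) * propCT L M β μ K p) with hsoft_def
  have hhardWd : ∀ p : FreqMomentum L M, hard p ≠ 0 → Wd t p ≠ 0 := by
    intro p hp hW
    exact hp (by simp only [hhard_def, hW, Complex.ofReal_zero, zero_mul])
  -- Step 1: collapse the partner sum and decompose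
  have hobj := klph_directRow_eq β μ K (Φ j t) (Wd t) F c x y
  have hdec := klph_transfer_decomp_abstract (L := L) (M := M) q hard soft F
  -- Step 2: the main term is O6e″'s object with `W p σ = F p⁻ σ p + F p σ p⁺`
  have hprof := klph_phValue_row_profile_ref_le (L := L) (M := M) hK hβ hβL n ht Φ hΦ Wd hWd hj
    (fun p σ => F (p.1, p.2 - q) σ p + F p σ (p.1, p.2 + q)) V₀ hε0 cen ρw Aw hρw hAw hδ
  have hrotw := klpw_phValue_row_weighted_le (L := L) (M := M) B hA hADt hlo hhi hβ0 n ht Φ hΦ Wd hWd j hΛr hM hr₁ hbd hlip hin hout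
    w₁ w₂ v₁ v₂ hvm₁ hvm₂ hvp₁ hvp₂ hvb₁ hvb₂ hw₁ hw₂ hwc₁ hwc₂ hw1₁ hw2₁ hw1₂ hw2₂ hLw hwlip₁ hwlip₂ hwb₁ hwb₂ V₀ hV
  have hmain := hprof.trans (add_le_add (add_le_add hrotw le_rfl) le_rfl)
  -- Step 3: the correction, sign-blind
  have hΦ1 : ∀ k : FreqMomentum L M, |Φ j t k| ≤ 1 := by
    intro k
    have h := klmf_runningSymbol_mem L M β μ K n (isSoftSymbol_compl (L := L) (M := M) β μ K hj).1 ht k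
    rw [hΦ]
    have hw : 0 ≤ hubbardCutoffWeightCT L M β μ K (klScale klE0 n) k := (salmhoferCutoff_mem_Icc _).1
    rw [abs_le]; constructor <;> linarith [h.1, h.2]
  have hn : ‖(((β * (L : ℝ) ^ 2 : ℝ) : ℂ))‖ = β * (L : ℝ) ^ 2 := by rw [Complex.norm_real, Real.norm_of_nonneg hβL2.le]
  have hH : ∀ p : FreqMomentum L M, hard p ≠ 0 → ‖hard p‖ ≤ β * (L : ℝ) ^ 2 * (128 / 3 / Λt ^ 2) := by
    intro p _
    have h : |Wd t p| * ‖propCT L M β μ K p‖ ≤ 128 / 3 / Λt ^ 2 := by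
      rw [hWd]; exact abs_derivWeight_mul_norm_propCT_le β μ K hΛt p
    have hp' : hard p = (((Wd t p) : ℝ) : ℂ) * (((β * (L : ℝ) ^ 2 : ℝ) : ℂ) * propCT L M β μ K p) := rfl
    rw [hp', norm_mul, norm_mul, hn, Complex.norm_real, Real.norm_eq_abs]
    calc |Wd t p| * (β * (L : ℝ) ^ 2 * ‖propCT L M β μ K p‖) = β * (L : ℝ) ^ 2 * (|Wd t p| * ‖propCT L M β μ K p‖) := by ring
      _ ≤ β * (L : ℝ) ^ 2 * (128 / 3 / Λt ^ 2) := mul_le_mul_of_nonneg_left h hβL2.le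
  -- the momentum-shifted soft line minus the unshifted one
  have hshift : ∀ (p : FreqMomentum L M) (k' : TorusSite 2 L), Wd t p ≠ 0 → |nambuXiCT L μ K k' - nambuXiCT L μ K p.2| ≤ dq →
      ‖propCT L M β μ K (p.1, k')‖ ≤ Gq → |Φ j t (p.1, k') - Φ j t p| ≤ εq →
      ‖soft (p.1, k') - soft p‖ ≤ β * (L : ℝ) ^ 2 * ((2 / Λt) * (dq * Gq + εq)) := by
    intro p k' hp hk hg hφ
    have hgp : ‖propCT L M β μ K p‖ ≤ 2 / Λt := by
      rw [hWd] at hp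
      exact klph_norm_propCT_le_of_derivWeight_ne_zero (L := L) β μ K hΛt hp
    have hres : ‖propCT L M β μ K (p.1, k') - propCT L M β μ K p‖ ≤ dq * ‖propCT L M β μ K p‖ * Gq := by
      have h := klph_norm_propCT_msub_le (L := L) (M := M) μ K hβ0.ne' p.1 p.2 k'
      calc ‖propCT L M β μ K (p.1, k') - propCT L M β μ K p‖ = ‖propCT L M β μ K (p.1, k') - propCT L M β μ K (p.1, p.2)‖ := rfl
        _ ≤ |nambuXiCT L μ K k' - nambuXiCT L μ K p.2| * ‖propCT L M β μ K (p.1, p.2)‖ * ‖propCT L M β μ K (p.1, k')‖ := h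
        _ ≤ dq * ‖propCT L M β μ K p‖ * Gq := by
            have : ‖propCT L M β μ K (p.1, p.2)‖ = ‖propCT L M β μ K p‖ := rfl
            rw [this]
            exact mul_le_mul (mul_le_mul_of_nonneg_right hk (norm_nonneg _)) hg (norm_nonneg _) (by positivity)
    have hsplit : soft (p.1, k') - soft p = (((β * (L : ℝ) ^ 2 : ℝ) : ℂ)) *
        ((((Φ j t (p.1, k')) : ℝ) : ℂ) * (propCT L M β μ K (p.1, k') - propCT L M β μ K p) +
          ((((Φ j t (p.1, k') - Φ j t p : ℝ)) : ℂ)) * propCT L M β μ K p) := by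
      simp only [hsoft_def]; push_cast; ring
    rw [hsplit, norm_mul, Complex.norm_real, Real.norm_of_nonneg hβL2.le]
    refine mul_le_mul_of_nonneg_left ?_ hβL2.le
    refine (norm_add_le _ _).trans ?_
    rw [norm_mul, norm_mul, Complex.norm_real, Complex.norm_real, Real.norm_eq_abs, Real.norm_eq_abs]
    have h1 : |Φ j t (p.1, k')| * ‖propCT L M β μ K (p.1, k') - propCT L M β μ K p‖ ≤ 1 * (dq * (2 / Λt) * Gq) := by
      refine mul_le_mul (hΦ1 _) (hres.trans ?_) (norm_nonneg _) zero_le_one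
      exact mul_le_mul_of_nonneg_right (mul_le_mul_of_nonneg_left hgp hdq0) hG0
    have h2 : |Φ j t (p.1, k') - Φ j t p| * ‖propCT L M β μ K p‖ ≤ εq * (2 / Λt) := mul_le_mul hφ hgp (norm_nonneg _) hεq0
    calc |Φ j t (p.1, k')| * ‖propCT L M β μ K (p.1, k') - propCT L M β μ K p‖ + |Φ j t (p.1, k') - Φ j t p| * ‖propCT L M β μ K p‖
        ≤ 1 * (dq * (2 / Λt) * Gq) + εq * (2 / Λt) := add_le_add h1 h2
      _ = (2 / Λt) * (dq * Gq + εq) := by ring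
  have hE : ∀ p : FreqMomentum L M, hard p ≠ 0 →
      ‖soft ((fun p : FreqMomentum L M => ((p.1, p.2 - q) : FreqMomentum L M)) p) - soft p‖ ≤ β * (L : ℝ) ^ 2 * ((2 / Λt) * (dq * Gq + εq)) ∧
        ‖soft ((fun p : FreqMomentum L M => ((p.1, p.2 + q) : FreqMomentum L M)) p) - soft p‖ ≤ β * (L : ℝ) ^ 2 * ((2 / Λt) * (dq * Gq + εq)) := by
    intro p hp
    have hW := hhardWd p hp
    have hk1 : |nambuXiCT L μ K (p.2 - q) - nambuXiCT L μ K p.2| ≤ dq := (hdq p.2).1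
    have hk2 : |nambuXiCT L μ K (p.2 + q) - nambuXiCT L μ K p.2| ≤ dq := (hdq p.2).2
    exact ⟨hshift p (p.2 - q) hW hk1 (hG p hW).1 (hε p hW).1, hshift p (p.2 + q) hW hk2 (hG p hW).2 (hε p hW).2⟩
  have hcorr := klph_shift_corr_abstract_le (L := L) (M := M) (fun p : FreqMomentum L M => ((p.1, p.2 + q) : FreqMomentum L M))
    (fun p : FreqMomentum L M => ((p.1, p.2 - q) : FreqMomentum L M)) hard soft F (by positivity) (by positivity) hH hE
    (fun p σ hp => hF p σ (hhardWd p hp))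
  -- the support of `hard` is the support of `Ẇ`
  have hcard : ((univ.filter fun p : FreqMomentum L M => hard p ≠ 0).card : ℝ) ≤ ((univ.filter fun p : FreqMomentum L M => Wd t p ≠ 0).card : ℝ) := by
    exact_mod_cast Finset.card_le_card (fun p hp => mem_filter.mpr ⟨mem_univ _, hhardWd p (mem_filter.mp hp).2⟩)
  -- assemble
  rw [hobj]
  have e1 : ∀ p : FreqMomentum L M, ((p.1, p.2 + x - y) : FreqMomentum L M) = (p.1, p.2 + q) := fun p => by rw [hq_def, add_sub_assoc]
  simp only [e1]
  have hgoal : (∑ p : FreqMomentum L M, ∑ σ : Fin 2,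
        (((((Φ j t p) : ℝ) : ℂ) * (((β * (L : ℝ) ^ 2 : ℝ) : ℂ) * propCT L M β μ K p)) *
              ((((Wd t (p.1, p.2 + q)) : ℝ) : ℂ) * (((β * (L : ℝ) ^ 2 : ℝ) : ℂ) * propCT L M β μ K (p.1, p.2 + q))) +
            ((((Wd t p) : ℝ) : ℂ) * (((β * (L : ℝ) ^ 2 : ℝ) : ℂ) * propCT L M β μ K p)) *
              ((((Φ j t (p.1, p.2 + q)) : ℝ) : ℂ) * (((β * (L : ℝ) ^ 2 : ℝ) : ℂ) * propCT L M β μ K (p.1, p.2 + q)))) *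
          F p σ (p.1, p.2 + q)) =
      ∑ p : FreqMomentum L M, ∑ σ : Fin 2, (soft p * hard (p.1, p.2 + q) + hard p * soft (p.1, p.2 + q)) * F p σ (p.1, p.2 + q) := by
    rfl
  rw [hgoal, hdec]
  set NW : ℝ := ((univ.filter fun p : FreqMomentum L M => Wd t p ≠ 0).card : ℝ) with hNW
  set X : ℝ := 2 * (β * (L : ℝ) ^ 2 * (128 / 3 / Λt ^ 2) * (2 * (β * (L : ℝ) ^ 2 * ((2 / Λt) * (dq * Gq + εq))) * Finf)) with hX
  have hX0 : 0 ≤ X := by positivity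
  have hcorr' : ‖∑ p : FreqMomentum L M, ∑ σ : Fin 2,
      hard p * ((soft (p.1, p.2 - q) - soft p) * F (p.1, p.2 - q) σ p + (soft (p.1, p.2 + q) - soft p) * F p σ (p.1, p.2 + q))‖ ≤ NW * X :=
    hcorr.trans (mul_le_mul_of_nonneg_right hcard hX0)
  have hnorm : (klScale klE0 n - klScale klE0 (n + 1)) * ((β * (L : ℝ) ^ 2) ^ 3)⁻¹ * (NW * X) =
      (klScale klE0 n - klScale klE0 (n + 1)) * NW * (β * (L : ℝ) ^ 2)⁻¹ * ((128 / 3 / Λt ^ 2) * (2 * (2 * ((2 / Λt) * (dq * Gq + εq)) * Finf))) := by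
    rw [hX]; field_simp
  calc (klScale klE0 n - klScale klE0 (n + 1)) * ((β * (L : ℝ) ^ 2) ^ 3)⁻¹ *
        ‖(∑ p : FreqMomentum L M, ∑ σ : Fin 2, hard p * soft p * (F (p.1, p.2 - q) σ p + F p σ (p.1, p.2 + q))) +
          ∑ p : FreqMomentum L M, ∑ σ : Fin 2,
            hard p * ((soft (p.1, p.2 - q) - soft p) * F (p.1, p.2 - q) σ p + (soft (p.1, p.2 + q) - soft p) * F p σ (p.1, p.2 + q))‖
      ≤ (klScale klE0 n - klScale klE0 (n + 1)) * ((β * (L : ℝ) ^ 2) ^ 3)⁻¹ *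
          (‖∑ p : FreqMomentum L M, ∑ σ : Fin 2, hard p * soft p * (F (p.1, p.2 - q) σ p + F p σ (p.1, p.2 + q))‖ + NW * X) :=
        mul_le_mul_of_nonneg_left ((norm_add_le _ _).trans (by linarith [hcorr'])) hC
    _ = (klScale klE0 n - klScale klE0 (n + 1)) * ((β * (L : ℝ) ^ 2) ^ 3)⁻¹ *
          ‖∑ p : FreqMomentum L M, ∑ σ : Fin 2, hard p * soft p * (F (p.1, p.2 - q) σ p + F p σ (p.1, p.2 + q))‖ +
        (klScale klE0 n - klScale klE0 (n + 1)) * ((β * (L : ℝ) ^ 2) ^ 3)⁻¹ * (NW * X) := by ring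
    _ ≤ _ := by rw [hnorm]; linarith [hmain]

end TransferWeighted

end Summit.HubbardSuperconductivity.HubbardSuperconductivity.Theorems.KLRegimeSplit

end
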